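import Summits.QuantumAdvantage.QuantumAdvantage.Theorems.OddPrimeWalkOddConfig
import Literature.Computability.QuantumComplexity.QuadraticPolarForm

/-!
# The ODD-CONFIGURATION IDENTITY of the u-walk game across a separator — part 2/2: far-affine play

Support item stmt-QuantumAdvantage-24030 `FarAffinePairLaw` (planner qa-qnc0-p2 g29, ROUND-29 §4.3(1)–4.4, THM 29-A(ii)).  AUTHORED AND
PROVED BY THE PLANNER SEAT qa-qnc0-p2 g29 (`HOME/qa-qnc0-p2/line29/ConfigParity.lean`, second half, farm rc 0); landed verbatim
(one-line docstrings added) by qn-prover-3 g18, ask P2-29d.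

§1 the second difference `sq f u x y` in `ZMod 2` and the two induction lemmas (`sq_single`, `sq_zero`: vanishing squares on pairs of
unit far directions ⇒ `f` affine along all far-supported directions); §2 the 81-point corollary `affine_exists_lose` (zero-sum class
triples on both sides ⇒ a lost glued pair, via `configParity`); §3 the bridge from the FILED hypothesis of `FarAffinePairLaw`
(`|S| = 2` powerset-filter parities) to the `sq = 0` form (`hAffA_of_filed`, `hAffB_of_filed`).
WHAT THIS IS NOT: instrument; the averaging step of stmt-24030 is not here; separation NOT moved.
-/

namespace Summit.QuantumAdvantage.AdviceFreeQNC0.OddConfig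

open Finset Literature.Computability.QuantumComplexity

variable {n : ℕ}

/-! ### Far-affine play: zero-sum class triples (⇒ stmt-24030 `FarAffinePairLaw` after averaging, ROUND-29 §4.3(1)–4.4) -/

/-- indicator of a Boolean in `ZMod 2`. -/
def indZ (b : Bool) : ZMod 2 := if b = true then 1 else 0

/-- pointwise xor of bit vectors. -/
def addV (u x : Fin n → Bool) : Fin n → Bool := fun k => xor (u k) (x k)

/-- the unit vector `e_i`. -/
def eV (i : Fin n) : Fin n → Bool := fun k => decide (k = i)

/-- the zero vector. -/
def zeroV : Fin n → Bool := fun _ => false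

/-- the "square" `f(u) + f(u+x) + f(u+y) + f(u+x+y)` in `ZMod 2`; vanishes for all `x, y` iff `f` is affine. -/
def sq (f : (Fin n → Bool) → Bool) (u x y : Fin n → Bool) : ZMod 2 :=
  indZ (f u) + indZ (f (addV u x)) + indZ (f (addV u y)) + indZ (f (addV u (addV x y)))


/-- adding the zero vector. -/
theorem addV_zeroV (u : Fin n → Bool) : addV u zeroV = u := by funext k; simp [addV, zeroV]

/-- `x + x = 0`. -/
theorem addV_self (x : Fin n → Bool) : addV x x = zeroV := by funext k; simp [addV, zeroV]

/-- associativity of `addV`. -/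
theorem addV_assoc (u x y : Fin n → Bool) : addV (addV u x) y = addV u (addV x y) := by
  funext k; simp only [addV]; cases u k <;> cases x k <;> cases y k <;> rfl

/-- commutativity of `addV`. -/
theorem addV_comm (x y : Fin n → Bool) : addV x y = addV y x := by
  funext k; simp only [addV]; cases x k <;> cases y k <;> rfl

/-- left-commutativity of `addV`. -/
theorem addV_left_comm (u x y : Fin n → Bool) : addV u (addV x y) = addV x (addV u y) := by
  funext k; simp only [addV]; cases u k <;> cases x k <;> cases y k <;> rfl

/-- `sq f w x e_i = 0` (square on the diagonal is trivial). -/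
theorem sq_diag (f : (Fin n → Bool) → Bool) (w x : Fin n → Bool) : sq f w x x = 0 := by
  unfold sq
  rw [addV_self, addV_zeroV]
  linear_combination (indZ (f w) + indZ (f (addV w x))) * QuadPolar.two_eq_zero

/-- clearing one bit. -/
def clearBit (x : Fin n → Bool) (b : Fin n) : Fin n → Bool := fun k => x k && decide (k ≠ b)

/-- a vector with bit `b` set is its cleared version plus `e_b`. -/
theorem eq_addV_clearBit {x : Fin n → Bool} {b : Fin n} (hxb : x b = true) :
    x = addV (clearBit x b) (eV b) := by
  funext k
  by_cases hk : k = b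
  · subst hk; simp [addV, clearBit, eV, hxb]
  · simp [addV, clearBit, eV, hk]

/-- clearing an unset bit does nothing. -/
theorem eq_clearBit {x : Fin n → Bool} {b : Fin n} (hxb : ¬ x b = true) : x = clearBit x b := by
  funext k
  by_cases hk : k = b
  · subst hk
    have : x k = false := by simpa using hxb
    simp [clearBit, this]
  · simp [clearBit, hk]

/-- support of the cleared vector. -/
theorem clearBit_support {x : Fin n → Bool} {b : Fin n} {S : Finset (Fin n)} {D : Fin n → Prop}
    (hx : ∀ k, x k = true → k ∈ insert b S ∧ D k) :
    ∀ k, clearBit x b k = true → k ∈ S ∧ D k := by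
  intro k hk
  simp only [clearBit, Bool.and_eq_true, decide_eq_true_eq] at hk
  obtain ⟨h1, h2⟩ := hx k hk.1
  exact ⟨Finset.mem_of_mem_insert_of_ne h1 hk.2, h2⟩

/-- **Lemma A**: vanishing squares on pairs of unit directions in `D` ⇒ vanishing squares `(x, e_i)` for every
`D`-supported `x`. -/
theorem sq_single (f : (Fin n → Bool) → Bool) (D : Fin n → Prop)
    (h2 : ∀ u : Fin n → Bool, ∀ i j : Fin n, D i → D j → i ≠ j → sq f u (eV i) (eV j) = 0) :
    ∀ (S : Finset (Fin n)) (x w : Fin n → Bool) (i : Fin n),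
      (∀ k, x k = true → k ∈ S ∧ D k) → D i → sq f w x (eV i) = 0 := by
  intro S
  induction S using Finset.induction_on with
  | empty =>
    intro x w i hx _
    have hx0 : x = zeroV := by
      funext k
      cases hk : x k
      · rfl
      · exact absurd (hx k hk).1 (Finset.notMem_empty k)
    subst hx0
    unfold sq
    rw [addV_zeroV, addV_comm zeroV, addV_zeroV]
    linear_combination (indZ (f w) + indZ (f (addV w (eV i)))) * QuadPolar.two_eq_zero
  | insert b S' hb ih =>
    intro x w i hx hi
    by_cases hxb : x b = true
    · have hDb : D b := (hx b hxb).2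
      have hx' := clearBit_support hx
      have A := ih (clearBit x b) w i hx' hi
      have B : sq f (addV w (clearBit x b)) (eV b) (eV i) = 0 := by
        by_cases hbi : b = i
        · subst hbi; exact sq_diag f _ _
        · exact h2 _ b i hDb hi hbi
      rw [eq_addV_clearBit hxb]
      unfold sq at A B ⊢
      rw [← addV_assoc w (clearBit x b) (eV b), addV_assoc (clearBit x b) (eV b) (eV i),
        ← addV_assoc w (clearBit x b) (addV (eV b) (eV i))]
      rw [addV_assoc w (clearBit x b) (eV i)] at B
      linear_combination A + B
        - (indZ (f (addV w (clearBit x b))) + indZ (f (addV w (addV (clearBit x b) (eV i))))) *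
          QuadPolar.two_eq_zero
    · have hx' : ∀ k, x k = true → k ∈ S' ∧ D k := by
        intro k hk
        obtain ⟨h1, h2⟩ := hx k hk
        refine ⟨Finset.mem_of_mem_insert_of_ne h1 ?_, h2⟩
        rintro rfl; exact hxb hk
      exact ih x w i hx' hi

/-- **Lemma B**: vanishing squares on pairs of unit directions in `D` ⇒ `sq f u x y = 0` for all
`D`-supported `x, y` (i.e. `f` is affine along `D`). -/
theorem sq_zero (f : (Fin n → Bool) → Bool) (D : Fin n → Prop)
    (h2 : ∀ u : Fin n → Bool, ∀ i j : Fin n, D i → D j → i ≠ j → sq f u (eV i) (eV j) = 0) :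
    ∀ (S : Finset (Fin n)) (y x u : Fin n → Bool),
      (∀ k, y k = true → k ∈ S ∧ D k) → (∀ k, x k = true → D k) → sq f u x y = 0 := by
  intro S
  induction S using Finset.induction_on with
  | empty =>
    intro y x u hy _
    have hy0 : y = zeroV := by
      funext k
      cases hk : y k
      · rfl
      · exact absurd (hy k hk).1 (Finset.notMem_empty k)
    subst hy0
    unfold sq
    rw [addV_zeroV, addV_zeroV]
    linear_combination (indZ (f u) + indZ (f (addV u x))) * QuadPolar.two_eq_zero
  | insert b S' hb ih =>
    intro y x u hy hx
    by_cases hyb : y b = true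
    · have hDb : D b := (hy b hyb).2
      have hy' := clearBit_support hy
      have A := ih (clearBit y b) x u hy' hx
      have B : sq f (addV u (clearBit y b)) x (eV b) = 0 :=
        sq_single f D h2 (Finset.univ.filter fun k => x k = true) x _ b
          (fun k hk => ⟨Finset.mem_filter.mpr ⟨Finset.mem_univ _, hk⟩, hx k hk⟩) hDb
      rw [eq_addV_clearBit hyb]
      unfold sq at A B ⊢
      rw [← addV_assoc u (clearBit y b) (eV b), addV_left_comm x (clearBit y b) (eV b),
        ← addV_assoc u (clearBit y b) (addV x (eV b))]
      rw [addV_assoc u (clearBit y b) x, addV_comm (clearBit y b) x] at B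
      linear_combination A + B
        - (indZ (f (addV u (clearBit y b))) + indZ (f (addV u (addV x (clearBit y b))))) *
          QuadPolar.two_eq_zero
    · have hy' : ∀ k, y k = true → k ∈ S' ∧ D k := by
        intro k hk
        obtain ⟨h1, h2⟩ := hy k hk
        refine ⟨Finset.mem_of_mem_insert_of_ne h1 ?_, h2⟩
        rintro rfl; exact hyb hk
      exact ih y x u hy' hx

/-! ### The 81-point corollary: zero-sum class triples on both sides -/

/-- adding a far-supported vector commutes with `glue` (second slot). -/
theorem glue_addV_far {m : ℕ} (s z t : Fin n → Bool) (ht : ∀ k : Fin n, k.val < m → t k = false) :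
    glue m s (addV z t) = addV (glue m s z) t := by
  funext k
  by_cases hk : k.val < m
  · simp [glue, addV, hk, ht k hk]
  · simp [glue, addV, hk]

/-- adding a near-supported vector commutes with `glue` (first slot). -/
theorem glue_addV_near {m : ℕ} (s t z : Fin n → Bool) (ht : ∀ k : Fin n, ¬ k.val < m → t k = false) :
    glue m (addV s t) z = addV (glue m s z) t := by
  funext k
  by_cases hk : k.val < m
  · simp [glue, addV, hk]
  · simp [glue, addV, hk, ht k hk]

/-- the configuration `(class a, slot t) ↦ x_a, y_a, x_a + y_a`. -/
def tri (x y : Fin 3 → Fin n → Bool) (j : Fin 3 × Fin 3) : Fin n → Bool :=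
  if j.2 = 0 then x j.1 else if j.2 = 1 then y j.1 else addV (x j.1) (y j.1)

/-- slot `0` of `tri` is `x`. -/
theorem tri_zero (x y : Fin 3 → Fin n → Bool) (a : Fin 3) : tri x y (a, 0) = x a := by simp [tri]
/-- slot `1` of `tri` is `y`. -/
theorem tri_one (x y : Fin 3 → Fin n → Bool) (a : Fin 3) : tri x y (a, 1) = y a := by simp [tri]
/-- slot `2` of `tri` is `x + y`. -/
theorem tri_two (x y : Fin 3 → Fin n → Bool) (a : Fin 3) : tri x y (a, 2) = addV (x a) (y a) := by simp [tri]

/-- sum over `Fin 3 × Fin 3` of a class-`b'` fibre = the three slots of class `b'`. -/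
theorem sum_fiber_tri (b' : Fin 3) (P : Fin 3 × Fin 3 → Prop) [DecidablePred P] :
    (∑ j : Fin 3 × Fin 3, if (j.1.val = b'.val ∧ P j) then (1 : ZMod 2) else 0)
      = (if P (b', 0) then (1 : ZMod 2) else 0) + (if P (b', 1) then 1 else 0) +
        (if P (b', 2) then 1 else 0) := by
  rw [Fintype.sum_prod_type, Finset.sum_eq_single b']
  · simp only [true_and, Fin.sum_univ_three]
  · intro a _ ha
    have hne : a.val ≠ b'.val := Fin.val_ne_iff.mpr ha
    simp [hne]
  · intro h; exact absurd (Finset.mem_univ _) h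

/-- **Affine corollary** (⇒ stmt-24030 `FarAffinePairLaw` after averaging, ROUND-29 §4.3(1)/§4.4): if every
cut `g ≤ m` is `𝔽₂`-affine in the bits `≥ m` and every cut `g > m` is `𝔽₂`-affine in the bits `< m` (own
side arbitrary), then for ANY zero-sum class triples `x_a, y_a, x_a + y_a ∈ A_a` (near-supported) and
`x'_b, y'_b, x'_b + y'_b ∈ B_b` (far-supported) one of the `81` glued pairs is lost. -/
theorem affine_exists_lose (m c : ℕ) (y : Fin (n + 1) → (Fin n → Bool) → Bool)
    (hAffA : ∀ g : Fin (n + 1), g.val ≤ m → ∀ u : Fin n → Bool, ∀ i j : Fin n,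
      ¬ i.val < m → ¬ j.val < m → i ≠ j → sq (y g) u (eV i) (eV j) = 0)
    (hAffB : ∀ g : Fin (n + 1), m < g.val → ∀ u : Fin n → Bool, ∀ i j : Fin n,
      i.val < m → j.val < m → i ≠ j → sq (y g) u (eV i) (eV j) = 0)
    (xa ya xb yb : Fin 3 → Fin n → Bool)
    (hxa : ∀ a k, ¬ k.val < m → xa a k = false) (hya : ∀ a k, ¬ k.val < m → ya a k = false)
    (hxb : ∀ b k, k.val < m → xb b k = false) (hyb : ∀ b k, k.val < m → yb b k = false)
    (hcA : ∀ a : Fin 3, wtA m (xa a) % 3 = a.val ∧ wtA m (ya a) % 3 = a.val ∧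
      wtA m (addV (xa a) (ya a)) % 3 = a.val)
    (hcB : ∀ b : Fin 3, wtB m (xb b) % 3 = b.val ∧ wtB m (yb b) % 3 = b.val ∧
      wtB m (addV (xb b) (yb b)) % 3 = b.val) :
    ∃ i j : Fin 3 × Fin 3, ringWinU c y (glue m (tri xa ya i) (tri xb yb j)) = false := by
  have hclsA : ∀ i : Fin 3 × Fin 3, wtA m (tri xa ya i) % 3 = i.1.val := by
    rintro ⟨a, t⟩
    simp only [tri]
    split_ifs
    · exact (hcA a).1
    · exact (hcA a).2.1
    · exact (hcA a).2.2
  have hclsB : ∀ j : Fin 3 × Fin 3, wtB m (tri xb yb j) % 3 = j.1.val := by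
    rintro ⟨b, t⟩
    simp only [tri]
    split_ifs
    · exact (hcB b).1
    · exact (hcB b).2.1
    · exact (hcB b).2.2
  have hxyb : ∀ b k, k.val < m → addV (xb b) (yb b) k = false := by
    intro b k hk; simp [addV, hxb b k hk, hyb b k hk]
  have hxya : ∀ a k, ¬ k.val < m → addV (xa a) (ya a) k = false := by
    intro a k hk; simp [addV, hxa a k hk, hya a k hk]
  refine configParity m c y (tri xa ya) (tri xb yb) (by simp) (by simp) ?_ ?_
  · intro g hg i b hb
    have key : ∀ b' : Fin 3, ((univ.filter fun j : Fin 3 × Fin 3 =>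
        wtB m (tri xb yb j) % 3 = b'.val ∧ y g (glue m (tri xa ya i) (tri xb yb j)) = true).card :
          ZMod 2) = indZ (y g (glue m (tri xa ya i) zeroV)) := by
      intro b'
      rw [natCast_card_filter]
      simp only [hclsB]
      rw [sum_fiber_tri b' (fun j => y g (glue m (tri xa ya i) (tri xb yb j)) = true)]
      rw [tri_zero, tri_one, tri_two]
      -- the square at base `glue m (tri xa ya i) zeroV` with far generators `xb b'`, `yb b'`
      have hsq := sq_zero (y g) (fun k : Fin n => ¬ k.val < m) (hAffA g hg)
        (Finset.univ.filter fun k => yb b' k = true) (yb b') (xb b') (glue m (tri xa ya i) zeroV)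
        (fun k hk => ⟨Finset.mem_filter.mpr ⟨Finset.mem_univ _, hk⟩,
          fun hlt => by simp [hyb b' k hlt] at hk⟩)
        (fun k hk hlt => by simp [hxb b' k hlt] at hk)
      have e1 : addV (glue m (tri xa ya i) zeroV) (xb b') = glue m (tri xa ya i) (xb b') := by
        rw [← glue_addV_far _ zeroV _ (hxb b'), addV_comm zeroV, addV_zeroV]
      have e2 : addV (glue m (tri xa ya i) zeroV) (yb b') = glue m (tri xa ya i) (yb b') := by
        rw [← glue_addV_far _ zeroV _ (hyb b'), addV_comm zeroV, addV_zeroV]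
      have e3 : addV (glue m (tri xa ya i) zeroV) (addV (xb b') (yb b'))
          = glue m (tri xa ya i) (addV (xb b') (yb b')) := by
        rw [← glue_addV_far _ zeroV _ (hxyb b'), addV_comm zeroV, addV_zeroV]
      unfold sq at hsq
      rw [e1, e2, e3] at hsq
      unfold indZ at hsq ⊢
      linear_combination hsq
        - (if y g (glue m (tri xa ya i) zeroV) = true then (1 : ZMod 2) else 0) * QuadPolar.two_eq_zero
    exact (ZMod.natCast_eq_natCast_iff' _ _ 2).mp
      ((key ⟨b, hb⟩).trans (key ⟨0, by norm_num⟩).symm)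
  · intro g hg j a ha
    have key : ∀ a' : Fin 3, ((univ.filter fun i : Fin 3 × Fin 3 =>
        wtA m (tri xa ya i) % 3 = a'.val ∧ y g (glue m (tri xa ya i) (tri xb yb j)) = true).card :
          ZMod 2) = indZ (y g (glue m zeroV (tri xb yb j))) := by
      intro a'
      rw [natCast_card_filter]
      simp only [hclsA]
      rw [sum_fiber_tri a' (fun i => y g (glue m (tri xa ya i) (tri xb yb j)) = true)]
      rw [tri_zero, tri_one, tri_two]
      have hsq := sq_zero (y g) (fun k : Fin n => k.val < m) (hAffB g hg)
        (Finset.univ.filter fun k => ya a' k = true) (ya a') (xa a') (glue m zeroV (tri xb yb j))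
        (fun k hk => ⟨Finset.mem_filter.mpr ⟨Finset.mem_univ _, hk⟩, by
            by_contra hn
            simp [hya a' k hn] at hk⟩)
        (fun k hk => by
          by_contra hn
          simp [hxa a' k hn] at hk)
      have e1 : addV (glue m zeroV (tri xb yb j)) (xa a') = glue m (xa a') (tri xb yb j) := by
        rw [← glue_addV_near zeroV _ _ (hxa a'), addV_comm zeroV, addV_zeroV]
      have e2 : addV (glue m zeroV (tri xb yb j)) (ya a') = glue m (ya a') (tri xb yb j) := by
        rw [← glue_addV_near zeroV _ _ (hya a'), addV_comm zeroV, addV_zeroV]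
      have e3 : addV (glue m zeroV (tri xb yb j)) (addV (xa a') (ya a'))
          = glue m (addV (xa a') (ya a')) (tri xb yb j) := by
        rw [← glue_addV_near zeroV _ _ (hxya a'), addV_comm zeroV, addV_zeroV]
      unfold sq at hsq
      rw [e1, e2, e3] at hsq
      unfold indZ at hsq ⊢
      linear_combination hsq
        - (if y g (glue m zeroV (tri xb yb j)) = true then (1 : ZMod 2) else 0) * QuadPolar.two_eq_zero
    exact (ZMod.natCast_eq_natCast_iff' _ _ 2).mp
      ((key ⟨a, ha⟩).trans (key ⟨0, by norm_num⟩).symm)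

/-! ### Bridge from the filed hypothesis of `FarAffinePairLaw` (second differences over `|S| = 2` vanish) -/

/-- flipping along the empty set does nothing. -/
theorem flip_empty (u : Fin n → Bool) : (fun k => xor (u k) (decide (k ∈ (∅ : Finset (Fin n))))) = u := by
  funext k; simp

/-- flipping along `{i}` adds `e_i`. -/
theorem flip_singleton (u : Fin n → Bool) (i : Fin n) :
    (fun k => xor (u k) (decide (k ∈ ({i} : Finset (Fin n))))) = addV u (eV i) := by
  funext k; simp [addV, eV]

/-- flipping along `{i, j}` adds `e_i + e_j`. -/
theorem flip_pair (u : Fin n → Bool) {i j : Fin n} (hij : i ≠ j) :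
    (fun k => xor (u k) (decide (k ∈ ({i, j} : Finset (Fin n))))) = addV u (addV (eV i) (eV j)) := by
  funext k
  by_cases hi : k = i
  · subst hi
    simp [addV, eV, hij]
  · by_cases hj : k = j
    · subst hj
      simp [addV, eV, hi]
    · simp [addV, eV, hi, hj]

/-- a sum over the powerset of a singleton. -/
theorem sum_powerset_singleton {β : Type} [AddCommMonoid β] (j : Fin n) (F : Finset (Fin n) → β) :
    (∑ T ∈ ({j} : Finset (Fin n)).powerset, F T) = F ∅ + F {j} := by
  have h := Finset.sum_powerset_insert (Finset.notMem_empty j) F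
  rw [Finset.insert_empty, Finset.powerset_empty, Finset.sum_singleton, Finset.sum_singleton,
    Finset.insert_empty] at h
  exact h

/-- `|S| = 2` second differences even (the filed form, `Bool.xor (u k) (decide (k ∈ T))` flips) ⇒ `sq = 0`. -/
theorem sq_of_powerset_even (f : (Fin n → Bool) → Bool) (u : Fin n → Bool) {i j : Fin n} (hij : i ≠ j)
    (h : ((({i, j} : Finset (Fin n)).powerset.filter fun T =>
      f (fun k => Bool.xor (u k) (decide (k ∈ T))) = true).card) % 2 = 0) :
    sq f u (eV i) (eV j) = 0 := by
  have hc : (((({i, j} : Finset (Fin n)).powerset.filter fun T =>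
      f (fun k => Bool.xor (u k) (decide (k ∈ T))) = true).card : ℕ) : ZMod 2) = ((0 : ℕ) : ZMod 2) :=
    (ZMod.natCast_eq_natCast_iff' _ _ 2).mpr (by rw [Nat.zero_mod]; exact h)
  rw [Nat.cast_zero, natCast_card_filter] at hc
  have hi : i ∉ ({j} : Finset (Fin n)) := by simpa using hij
  rw [Finset.sum_powerset_insert hi, sum_powerset_singleton, sum_powerset_singleton,
    Finset.insert_empty] at hc
  rw [flip_empty, flip_singleton, flip_singleton, flip_pair u hij] at hc
  unfold sq indZ
  linear_combination hc

/-- The hypothesis of `FarAffinePairLaw` for the cuts `g ≤ m`, in the form `affine_exists_lose` wants. -/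
theorem hAffA_of_filed (m : ℕ) (y : Fin (n + 1) → (Fin n → Bool) → Bool)
    (hfar : ∀ g : Fin (n + 1), g.val ≤ m → ∀ u : Fin n → Bool, ∀ S : Finset (Fin n), S.card = 2 →
      (∀ i ∈ S, m ≤ i.val) →
      (S.powerset.filter fun T => y g (fun i => Bool.xor (u i) (decide (i ∈ T))) = true).card % 2 = 0) :
    ∀ g : Fin (n + 1), g.val ≤ m → ∀ u : Fin n → Bool, ∀ i j : Fin n,
      ¬ i.val < m → ¬ j.val < m → i ≠ j → sq (y g) u (eV i) (eV j) = 0 := by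
  intro g hg u i j hi hj hij
  apply sq_of_powerset_even (y g) u hij
  apply hfar g hg u {i, j} (Finset.card_pair hij)
  intro k hk
  rcases Finset.mem_insert.mp hk with rfl | hk
  · omega
  · rw [Finset.mem_singleton] at hk; subst hk; omega

/-- The hypothesis of `FarAffinePairLaw` for the cuts `g > m`. -/
theorem hAffB_of_filed (m : ℕ) (y : Fin (n + 1) → (Fin n → Bool) → Bool)
    (hnear : ∀ g : Fin (n + 1), m < g.val → ∀ u : Fin n → Bool, ∀ S : Finset (Fin n), S.card = 2 →
      (∀ i ∈ S, i.val < m) →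
      (S.powerset.filter fun T => y g (fun i => Bool.xor (u i) (decide (i ∈ T))) = true).card % 2 = 0) :
    ∀ g : Fin (n + 1), m < g.val → ∀ u : Fin n → Bool, ∀ i j : Fin n,
      i.val < m → j.val < m → i ≠ j → sq (y g) u (eV i) (eV j) = 0 := by
  intro g hg u i j hi hj hij
  apply sq_of_powerset_even (y g) u hij
  apply hnear g hg u {i, j} (Finset.card_pair hij)
  intro k hk
  rcases Finset.mem_insert.mp hk with rfl | hk
  · exact hi
  · rw [Finset.mem_singleton] at hk; subst hk; exact hj

end Summit.QuantumAdvantage.AdviceFreeQNC0.OddConfig
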